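import Mathlib.Topology.Algebra.InfiniteSum.Real
import Mathlib.Analysis.SpecificLimits.Basic
import Mathlib.Algebra.BigOperators.Fin
import HarnessLib

/-!
# ζ(5) search — REPLAY KERNEL, non-terminating sums: telescoping a certificate over `t ≥ 0` (cell `pub-zeta5`, certifier `cert-1`)

HONEST FRAMING: systematic search; no irrationality claim unless certified.

Companion of `Certificates/Telescoping.lean` (terminating sums). For a NON-terminating definite sum
`J(n) = Σ_{t ≥ 0} T(n,t)` (the cell's dual very-well-poised series `F̃₇(b)`, fam-catalan's `₃F₂`-type
`J_n`, fam-measure's two tales) a creative-telescoping certificate has the same termwise shape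
`Σ_i P_i(n) T(n+i,t) = G(n,t+1) − G(n,t)` for all `t ≥ 0`, and the rigour step is the BOUNDARY lemma
`G(n,t) → 0` as `t → ∞` (fam-tele `boundary.py`: `tdeg(num R) − tdeg(den R) + tdeg T < 0`) plus the value
`G(n,0)` (often `0` by a vanishing factor). This file is the generic Step 3 for that case, over `ℝ`:

* `hasSum_of_telescope` — if each `F_i` is summable, `Σ_i P_i F_i(t) = G(t+1) − G(t)` and `G → L`, then
  `Σ_t (G(t+1) − G(t))` has sum `L − G 0`;
* `sum_mul_tsum_eq_of_telescope` — hence `Σ_i P_i · (Σ'_t F_i t) = L − G 0`;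
* `sum_mul_tsum_eq_zero_of_telescope` — natural boundaries `G 0 = 0`, `G → 0`: the recurrence
  `Σ_i P_i J_i = 0`; fixed-arity forms `telescopeSeries₃/₄_eq_zero` (orders 2 and 3).
The re-attach step (ratio lemmas for Pochhammer/Γ-quotients) and the boundary lemma are family-specific.
No named facts.
-/

namespace Summit.KontsevichZagierPeriods.Zeta5Search.Certificates

open Filter Topology Finset

/-- **Telescoping over `t ≥ 0` with a limit at infinity.** If every `F_i` (`i ∈ s`) is summable,
`Σ_{i∈s} P_i F_i(t) = G(t+1) − G(t)` for all `t`, and `G(t) → L`, then `Σ_t (G(t+1) − G(t)) = L − G(0)` as a `HasSum`. -/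
theorem hasSum_of_telescope {ι : Type*} (s : Finset ι) (P : ι → ℝ) (F : ι → ℕ → ℝ) (G : ℕ → ℝ) {L : ℝ}
    (h : ∀ t, ∑ i ∈ s, P i * F i t = G (t + 1) - G t) (hF : ∀ i ∈ s, Summable (F i))
    (hG : Tendsto G atTop (𝓝 L)) : HasSum (fun t => G (t + 1) - G t) (L - G 0) := by
  -- the telescoping function is a finite combination of summable functions, hence summable
  have hsum : Summable (fun t => G (t + 1) - G t) := by
    have : Summable (fun t => ∑ i ∈ s, P i * F i t) :=
      summable_sum fun i hi => (hF i hi).mul_left (P i)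
    exact this.congr fun t => h t
  -- its sum is the limit of the partial sums `G N − G 0`
  have hpart : Tendsto (fun N : ℕ => ∑ t ∈ range N, (G (t + 1) - G t)) atTop (𝓝 (L - G 0)) := by
    have e : (fun N : ℕ => ∑ t ∈ range N, (G (t + 1) - G t)) = fun N => G N - G 0 := by
      funext N; exact Finset.sum_range_sub G N
    rw [e]
    exact hG.sub tendsto_const_nhds
  have h1 := hsum.hasSum.tendsto_sum_nat
  have heq : ∑' t, (G (t + 1) - G t) = L - G 0 := tendsto_nhds_unique h1 hpart
  rw [← heq]
  exact hsum.hasSum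

/-- **Creative telescoping, non-terminating sum (general arity)**: under the hypotheses of
`hasSum_of_telescope`, `Σ_{i∈s} P_i · Σ'_t F_i(t) = L − G(0)`. -/
theorem sum_mul_tsum_eq_of_telescope {ι : Type*} (s : Finset ι) (P : ι → ℝ) (F : ι → ℕ → ℝ) (G : ℕ → ℝ)
    {L : ℝ} (h : ∀ t, ∑ i ∈ s, P i * F i t = G (t + 1) - G t) (hF : ∀ i ∈ s, Summable (F i))
    (hG : Tendsto G atTop (𝓝 L)) : ∑ i ∈ s, P i * ∑' t, F i t = L - G 0 := by
  have hs := hasSum_of_telescope s P F G h hF hG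
  calc ∑ i ∈ s, P i * ∑' t, F i t = ∑ i ∈ s, ∑' t, P i * F i t := by
        refine sum_congr rfl fun i hi => ?_
        rw [(hF i hi).tsum_mul_left]
    _ = ∑' t, ∑ i ∈ s, P i * F i t := (Summable.tsum_finsetSum fun i hi => (hF i hi).mul_left (P i)).symm
    _ = ∑' t, (G (t + 1) - G t) := tsum_congr h
    _ = L - G 0 := hs.tsum_eq

/-- Natural boundaries (`G(0) = 0`, `G → 0`): `Σ_{i∈s} P_i · Σ'_t F_i(t) = 0`. -/
theorem sum_mul_tsum_eq_zero_of_telescope {ι : Type*} (s : Finset ι) (P : ι → ℝ) (F : ι → ℕ → ℝ)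
    (G : ℕ → ℝ) (h : ∀ t, ∑ i ∈ s, P i * F i t = G (t + 1) - G t) (hF : ∀ i ∈ s, Summable (F i))
    (hG : Tendsto G atTop (𝓝 0)) (h0 : G 0 = 0) : ∑ i ∈ s, P i * ∑' t, F i t = 0 := by
  rw [sum_mul_tsum_eq_of_telescope s P F G h hF hG, h0, sub_zero]

/-- **Order-2 telescoper, non-terminating**: `P₀ J₀ + P₁ J₁ + P₂ J₂ = 0` for `J_i = Σ'_t F_i t`. -/
theorem telescopeSeries₃_eq_zero (P₀ P₁ P₂ : ℝ) (F₀ F₁ F₂ : ℕ → ℝ) (G : ℕ → ℝ)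
    (h : ∀ t, P₀ * F₀ t + P₁ * F₁ t + P₂ * F₂ t = G (t + 1) - G t)
    (h₀ : Summable F₀) (h₁ : Summable F₁) (h₂ : Summable F₂)
    (hG : Tendsto G atTop (𝓝 0)) (hG0 : G 0 = 0) :
    P₀ * ∑' t, F₀ t + P₁ * ∑' t, F₁ t + P₂ * ∑' t, F₂ t = 0 := by
  have hs : ∀ t, ∑ i ∈ (univ : Finset (Fin 3)), ![P₀, P₁, P₂] i * ![F₀, F₁, F₂] i t = G (t + 1) - G t := by
    intro t; rw [Fin.sum_univ_three]; simpa [add_assoc] using h t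
  have hF : ∀ i ∈ (univ : Finset (Fin 3)), Summable (![F₀, F₁, F₂] i) := by
    intro i _; fin_cases i <;> simpa
  have := sum_mul_tsum_eq_zero_of_telescope univ ![P₀, P₁, P₂] ![F₀, F₁, F₂] G hs hF hG hG0
  rw [Fin.sum_univ_three] at this
  simpa [add_assoc] using this

/-- **Order-3 telescoper, non-terminating**: `P₀ J₀ + P₁ J₁ + P₂ J₂ + P₃ J₃ = 0` for `J_i = Σ'_t F_i t`. -/
theorem telescopeSeries₄_eq_zero (P₀ P₁ P₂ P₃ : ℝ) (F₀ F₁ F₂ F₃ : ℕ → ℝ) (G : ℕ → ℝ)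
    (h : ∀ t, P₀ * F₀ t + P₁ * F₁ t + P₂ * F₂ t + P₃ * F₃ t = G (t + 1) - G t)
    (h₀ : Summable F₀) (h₁ : Summable F₁) (h₂ : Summable F₂) (h₃ : Summable F₃)
    (hG : Tendsto G atTop (𝓝 0)) (hG0 : G 0 = 0) :
    P₀ * ∑' t, F₀ t + P₁ * ∑' t, F₁ t + P₂ * ∑' t, F₂ t + P₃ * ∑' t, F₃ t = 0 := by
  have hs : ∀ t, ∑ i ∈ (univ : Finset (Fin 4)),
      ![P₀, P₁, P₂, P₃] i * ![F₀, F₁, F₂, F₃] i t = G (t + 1) - G t := by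
    intro t; rw [Fin.sum_univ_four]; simpa [add_assoc] using h t
  have hF : ∀ i ∈ (univ : Finset (Fin 4)), Summable (![F₀, F₁, F₂, F₃] i) := by
    intro i _; fin_cases i <;> simpa
  have := sum_mul_tsum_eq_zero_of_telescope univ ![P₀, P₁, P₂, P₃] ![F₀, F₁, F₂, F₃] G hs hF hG hG0
  rw [Fin.sum_univ_four] at this
  simpa [add_assoc] using this

end Summit.KontsevichZagierPeriods.Zeta5Search.Certificates
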